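/-
Copyright (c) 2026 the pub-hodgecm-mathlib formalisation cell (harness21).  Prover seat hodgecm-mathlib-K2E3-p25 (g3) (L4 architect), HCML Track B «K2-LIT» ∕ h413
(`stmt-HodgeConjecture-24833`).  NR-1′ «THE COMPOSING RE-CUT» (director s1979∕s1980, 2026-09-04): the two Harish-Chandra letters of the organ `stub_EllipticInputs`
NARROWED to what HC_CM consumes — rank `2 ≤ N ≤ 3` and non-split places.  DEFINITIONS ONLY (two `Prop`s), the root of the `…LeThree` sweep.
-/
import Literature.NumberTheory.Rogawski1990.Ch12Sec7CharacterInputs   -- ★ `normalizedCharacter_locallyBounded` (body copied below with the narrowing prefix); brings `Ch1`, `IsLocSmooth`, `unitModulusChar`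
import Literature.NumberTheory.Rogawski1990.Ch1                      -- ★ `Ch1.characterLocallyIntegrable` (body copied below with the narrowing prefix)
import HarnessLib

/-!
# NR-1′ — the two Harish-Chandra letters of `stub_EllipticInputs` narrowed to `2 ≤ N ≤ 3` and non-split `v` (definitions)

Cell `pub/hodgecm-mathlib`, crux H413 = `stmt-HodgeConjecture-24833`, line L4 `stub_StCharTS`; director rulings NR-1 (s1977) ∕ NR-1′ (s1979, s1980 «GO — LeThree SWEEP»);
audit K2E3-audit1 (g0) Q1 ∕ LINE #2; architect memo `K2/K2E3-p25/g3/NR1-narrowing-cone.K2E3-p25-g3.md`.  DEFINITIONS ONLY (`--kind definition`); no theorem, no instance,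
no notation.  The two Props are the ★ bodies of `Literature.NumberTheory.Rogawski1990.Ch1.characterLocallyIntegrable` ([HarishChandra1999, Thm. 16.3 first clause];
[Rogawski1990, §1.6 p. 5]) and `Literature.NumberTheory.Rogawski1990.normalizedCharacter_locallyBounded` ([HarishChandra1999, Thm. 16.3 second clause]) VERBATIM with
ONE inserted prefix after `(N : ℕ)`: `2 ≤ N → N ≤ 3 →`, and ONE inserted hypothesis after the place `v`: `(∀ w : PlacesOver L v, IsCMField.complexConj L • w.1 = w.1) →`
(the organ's own spelling of «`v` non-split»).  WHY: every application of the two letters in the tree is at `N ∈ {2, 3}`, a Hermitian non-degenerate `H`, a finite NON-SPLIT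
place (audit1 Q1 table, sites A1–A4 of the memo); the ∀-`N` letters as typed demand Harish-Chandra's theorem in every rank ((11-ge4)), which HC_CM never uses.  These two
Props are the binder types of every `…LeThree` twin of the cone (★ CharField, HcbH, HFields, HFieldsHcb, HbOnMc, L2dOfHcb, RUNG0₂₂, the K2E3 payers) and, at the end of
the sweep, conjuncts 1–2 of the re-cut organ `stub_EllipticInputs` and tier-0 stubs 1–2 of `K2_E3_EllipticInputs`.

HONEST LABEL: HC_CM is proved only modulo the 7 printed citations (2 remaining named inputs: hLiu418 = `stmt-HodgeConjecture-24832`, h413 = `stmt-HodgeConjecture-24833`)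
until rung 0 closes; these are DEFINITIONS (no claim); the narrowed letters are TRUE statements strictly weaker than the printed theorem; count-neutral.

## References
* [HarishChandra1999] Harish-Chandra (notes by S. DeBacker, P. J. Sally), *Admissible Invariant Distributions on Reductive p-adic Groups*, ULS 16 (1999), Thm. 16.3.
* [Rogawski1990] J. D. Rogawski, *Automorphic Representations of Unitary Groups in Three Variables*, Ann. of Math. Stud. 123 (1990), §1.6 p. 5; §4.9 p. 54; §12.7 p. 193.
-/

set_option autoImplicit false
set_option linter.dupNamespace false

noncomputable section

open NumberField IsDedekindDomain MeasureTheory Filter Topology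
open scoped Matrix NNReal MatrixGroups
open Literature.NumberTheory Literature.NumberTheory.Rogawski1990 Literature.NumberTheory.Automorphic Literature.NumberTheory.Automorphic.UnitaryGroup

namespace Summit.HodgeConjecture.HodgeConjecture.Cruxes.H413.K2E3CharLettersLeThreeDefs

/-- **hHC₃ — Harish-Chandra's local integrability letter NARROWED to `2 ≤ N ≤ 3` and non-split `v`**: for every CM field `L`, `2 ≤ N ≤ 3`, every Hermitian
non-degenerate `H ∈ M_N(L)`, every finite place `v` of `L⁺` with every `w ∣ v` fixed by complex conjugation, every Haar measure `μ` on `U(H)(L⁺_v)` and every irreducible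
smooth class `c`, there is a locally integrable `Θ`, locally constant on the regular set, with `Tr c(f) = ∫ f·Θ dμ` on `C_c^∞` — the body of ★ `Ch1.characterLocallyIntegrable`
VERBATIM under the two inserted hypotheses (Harish-Chandra 1999 Thm. 16.3, first clause; Rogawski 1990 §1.6 p. 5 — an in-house NARROWING of the tree's ★ Literature
Prop, not a new printed fact: deliberately no cite-tag, so that it stays in this `Theorems/…Defs` file). -/
def characterLocallyIntegrableLeThree : Prop :=
  ∀ (L : Type) [Field L] [NumberField L] [IsCMField L] (N : ℕ), 2 ≤ N → N ≤ 3 → ∀ (H : Matrix (Fin N) (Fin N) L),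
    (H.map (cmConjRingHom L))ᵀ = H → H.det ≠ 0 →
    ∀ (v : HeightOneSpectrum (𝓞 ↥(maximalRealSubfield L))), (∀ w : PlacesOver L v, IsCMField.complexConj L • w.1 = w.1) →
      ∀ [MeasurableSpace ((UnitaryGroup.cmDatum L N H).Local v)] [BorelSpace ((UnitaryGroup.cmDatum L N H).Local v)]
      (μ : Measure ((UnitaryGroup.cmDatum L N H).Local v)) [μ.IsHaarMeasure]
      (c : IrrClass ((UnitaryGroup.cmDatum L N H).Local v)),
      ∃ Θ : (UnitaryGroup.cmDatum L N H).Local v → ℂ,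
        LocallyIntegrable Θ μ ∧
        IsLocallyConstant (fun g : {g : (UnitaryGroup.cmDatum L N H).Local v // IsRegularElt (g.1 : GL (Fin N) (UnitaryGroup.LocalRing L v))} => Θ g.1) ∧
        ∀ f : (UnitaryGroup.cmDatum L N H).Local v → ℂ, f ∈ SchwartzBruhat ((UnitaryGroup.cmDatum L N H).Local v) →
          c.smoothTrace μ f = ∫ g, f g * Θ g ∂μ

/-- **hHCB₃ — Harish-Chandra's local boundedness letter `|D_G|^{1∕2}·Θ_π` NARROWED to `2 ≤ N ≤ 3` and non-split `v`**: the body of ★ `normalizedCharacter_locallyBounded`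
VERBATIM under the two inserted hypotheses (`2 ≤ N → N ≤ 3 →` after `N`; `(∀ w ∣ v, conj • w = w) →` after `v`) (Harish-Chandra 1999 Thm. 16.3, second clause;
Rogawski 1990 §1.6 p. 5, §4.9 p. 54, §12.7 p. 193 — an in-house NARROWING of the tree's ★ Literature Prop, not a new printed fact: deliberately no cite-tag). -/
def normalizedCharacter_locallyBoundedLeThree : Prop :=
  ∀ (L : Type) [Field L] [NumberField L] [IsCMField L] (N : ℕ), 2 ≤ N → N ≤ 3 → ∀ (H : Matrix (Fin N) (Fin N) L),
    (H.map (cmConjRingHom L))ᵀ = H → H.det ≠ 0 →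
    ∀ (v : HeightOneSpectrum (𝓞 ↥(maximalRealSubfield L))), (∀ w : PlacesOver L v, IsCMField.complexConj L • w.1 = w.1) →
      ∀ [MeasurableSpace ((UnitaryGroup.cmDatum L N H).Local v)] [BorelSpace ((UnitaryGroup.cmDatum L N H).Local v)]
      (μ : Measure ((UnitaryGroup.cmDatum L N H).Local v)) [μ.IsHaarMeasure]
      (c : IrrClass ((UnitaryGroup.cmDatum L N H).Local v)) (Θ : (UnitaryGroup.cmDatum L N H).Local v → ℂ),
      LocallyIntegrable Θ μ →
      (∀ x : (UnitaryGroup.cmDatum L N H).Local v,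
        IsRegularElt (x.val : GL (Fin N) (UnitaryGroup.LocalRing L v)) → ∀ᶠ y in 𝓝 x, Θ y = Θ x) →
      (∀ φ : (UnitaryGroup.cmDatum L N H).Local v → ℂ, IsLocSmooth φ → c.smoothTrace μ φ = ∫ x, φ x * Θ x ∂μ) →
    ∀ C : Set ((UnitaryGroup.cmDatum L N H).Local v), IsCompact C →
      ∃ B : ℝ, ∀ g ∈ C, ∀ u : (UnitaryGroup.LocalRing L v)ˣ,
        (u : UnitaryGroup.LocalRing L v) *
            (((g.val : GL (Fin N) (UnitaryGroup.LocalRing L v)) : Matrix (Fin N) (Fin N) (UnitaryGroup.LocalRing L v)).det) ^ (N - 1) =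
          (((g.val : GL (Fin N) (UnitaryGroup.LocalRing L v)) : Matrix (Fin N) (Fin N) (UnitaryGroup.LocalRing L v)).charpoly).discr →
        ((NNReal.sqrt (NNReal.sqrt (unitModulusChar (UnitaryGroup.LocalRing L v) u)) : ℝ≥0) : ℝ) * ‖Θ g‖ ≤ B

end Summit.HodgeConjecture.HodgeConjecture.Cruxes.H413.K2E3CharLettersLeThreeDefs

end
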